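import Literature.Claims.NS.Lindgren2012
import Literature.Analysis.FluidPDE.ClassicalNSGlobalOfEnstrophyBound
import HarnessLib

/-!
# Solo salvage for claim C32 `Lindgren2012`, part 3 (cell `ns-claims`, D-0090): the closing step
# «bounded enstrophy ⇒ the solutions stay regular» is TRUE on `ℝ³` in the rendered class — kernel

Claim skeleton: `Literature/Claims/NS/Lindgren2012.lean` (J. Lindgren, arXiv:1207.1090 v3; typist
`ns-claims-typist-9` g2). Adjudicated #93: first failing step = `Step4_VanishingIntegral_kinematic`
(26) p. 3, false lemma (`…Theorems.Lindgren2012.not_Step4_VanishingIntegral_kinematic`, p487600).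
This file (seat `ns-claims-salvage-p3` g3, a-priori-identity family) discharges the paper's LAST
step, l.171 print p. 3 «It is well known that if the total enstrophy stays bounded, the solutions
stay regular», typed as `Step6_RegularityCriterion`:

* `exists_globalSolution_of_apriori_enstrophy_bound` — the ENSTROPHY DOOR ON `ℝ³` in the
  Beale–Kato–Majda class, read in the claim-side rendering (`Ruzmaikina2008.IsDatum` /
  `IsSolution` / `IsGlobalSolution`, the vocabulary shared by the a-priori-identity rows C25, C32):
  `ν > 0`; IF every class solution from `u₀` on every `[0,T]` obeys `∫|curl u(t)|² ≤ M`, THEN a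
  global solution in the class exists. It is the tree theorem
  `Literature.Analysis.FluidPDE.exists_global_classical_of_apriori_enstrophy_bound`
  (`ClassicalNSGlobalOfEnstrophyBound.lean`: Leray's blow-up alternative for smooth finite-energy
  solutions + Tao's class + the `div`–`curl` estimate + the `H¹` continuation principle), unpacked.
* `lindgren2012_step6_holds : Step6_RegularityCriterion` — the instance `M = ∫|curl u₀|²`.

With parts 1–2 (`SoloSalvageLindgren2012.lean`: Steps 1, 2, 5 kernel, p484197/p485039) the C32 row
reads: Steps 1, 2, 5, 6 KERNEL-TRUE, Step 3 (enstrophy evolution) classical, Step 4 the locator.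
Mathematics: Leray 1934 §33 (structure theorem), Constantin–Fefferman 1993 (end of proof: the
enstrophy bound implies regularity), Majda–Bertozzi 2002 Thm 3.6 / §3.2; nothing here is the paper's.

Solo lane (`Theorems/SoloSalvage<Slug>….lean`, no item).

WHAT THIS IS NOT: not a claim about NS regularity or blow-up; not a claim about any author beyond the
typed locator.
-/

noncomputable section

-- The summit-side namespace repeats the summit name by design (D-0017 layout); tree precedent
-- `SoloSalvageLam2019.lean`.
set_option linter.dupNamespace false

open MeasureTheory Set
open scoped ENNReal NNReal ContDiff RealInnerProductSpace

namespace Summit.NavierStokesRegularity.NavierStokesRegularity.Theorems.Lindgren2012Salvage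

open Literature.Analysis.FluidPDE Literature.Claims.NS.Ruzmaikina2008 Literature.Claims.NS.Lindgren2012

/-- **The enstrophy door on `ℝ³`, claim-side rendering.** Let `ν > 0` and let `u₀` be a datum of the
class (`IsDatum`: smooth, divergence free, every derivative in `L²`). If there is `M` such that every
solution of the class from `u₀` on a closed slab `[0,T]` (`IsSolution ν T u₀ u p`, `T > 0`) satisfies
`∫ |curl u(t)|² ≤ M` for all `t ∈ [0,T]`, then a global solution in the class exists
(`IsGlobalSolution`: classical on `[0,∞) × ℝ³`, `u(0) = u₀`, all Sobolev norms bounded on every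
`[0,T]`). Unpacking of `exists_global_classical_of_apriori_enstrophy_bound`.
[cite: ConstantinFeffermanIndiana1993, §2 (end of proof)] [cite: MajdaBertozzi2002, Thm 3.6 and §3.2.3] -/
theorem exists_globalSolution_of_apriori_enstrophy_bound {ν : ℝ} (hν : 0 < ν)
    {u₀ : EuclideanSpace ℝ (Fin 3) → EuclideanSpace ℝ (Fin 3)} (hu₀ : IsDatum u₀) {M : ℝ}
    (hM : ∀ T : ℝ, 0 < T → ∀ (u : ℝ → EuclideanSpace ℝ (Fin 3) → EuclideanSpace ℝ (Fin 3))
      (p : ℝ → EuclideanSpace ℝ (Fin 3) → ℝ), IsSolution ν T u₀ u p →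
        ∀ t ∈ Icc 0 T, ∫ x, ‖curl (u t) x‖ ^ 2 ≤ M) :
    ∃ (u : ℝ → EuclideanSpace ℝ (Fin 3) → EuclideanSpace ℝ (Fin 3))
      (p : ℝ → EuclideanSpace ℝ (Fin 3) → ℝ), IsGlobalSolution ν u₀ u p := by
  obtain ⟨hsm, hdiv, hH⟩ := hu₀
  obtain ⟨u, p, hcl, hu0, -, -, hsob⟩ :=
    exists_global_classical_of_apriori_enstrophy_bound hν hsm hdiv hH (M := M)
      fun T hT u p hcl hu0 hsob t ht => hM T hT u p ⟨⟨hcl, hsob⟩, hu0⟩ t ht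
  exact ⟨u, p, hcl, hu0, hsob⟩

/-- **Step 6 of C32 is TRUE** — l.171 (print p. 3) «It is well known that if the total enstrophy
stays bounded, the solutions stay regular. QED.», typed as `Step6_RegularityCriterion`: for `ν > 0`
and a datum `u₀` of the class, if every solution from `u₀` on every `[0,T]` obeys `E(t) ≤ E(u₀)`,
a global solution in the class exists. Instance `M = ∫|curl u₀|²` of
`exists_globalSolution_of_apriori_enstrophy_bound`. (The paper's use of it is moot: its hypothesis
is delivered through Step 4, the adjudicated locator.)
[cite: Lindgren2012, l.171 (print p. 3)] [cite: ConstantinFeffermanIndiana1993, §2 (end of proof)] -/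
theorem lindgren2012_step6_holds : Literature.Claims.NS.Lindgren2012.Step6_RegularityCriterion := by
  intro ν hν u₀ hu₀ H
  exact exists_globalSolution_of_apriori_enstrophy_bound hν hu₀ (M := enstrophy u₀)
    fun T hT u p hsol t ht => H T hT u p hsol t ht

end Summit.NavierStokesRegularity.NavierStokesRegularity.Theorems.Lindgren2012Salvage

end
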